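import Mathlib
import Summits.ValiantsHypothesis.ValiantsHypothesis.Theorems.NewtonUnitEquationsDissociatedUniformTotalsLaw
import Summits.ValiantsHypothesis.ValiantsHypothesis.Theorems.NewtonUnitEquationsDissociatedUniformTotalsLawUnion
import Summits.ValiantsHypothesis.ValiantsHypothesis.Theorems.NewtonUnitEquationsDissociatedUniformTotalsLawIntervalUnion
import Literature.Computability.AlgebraicComplexity.NewtonPolygonTauProductBounds
import HarnessLib

/-!
# Crux `NewtonUnitEquations.DissociatedUniform` (stmt-ValiantsHypothesis-5905), `n = 3` totals law of model (Q**):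
# the INTERVAL union bound for ARBITRARY pairs, up to a logarithm — `#vert conv U_s([t,t+m)) ≤ 6q(log₂ q + 3)`

The located rung `IntervalUnionVertBound C` (`…TotalsLawIntervalUnion`: for all `a b : ℤ/q → ℝ²`, every cyclic interval
`Z = [t, t+m)`, every class `s`, `#vert conv ⋃_{z ∈ Z} P_{s-z} ≤ C·q`; OPEN, located `C = 5`, `C ≥ 3` necessary) is proved here UP
TO THE FACTOR `log₂ q`, for ARBITRARY curves (no convex position, no injectivity, any labelling):
* `unionVert_cycInterval_le_log : unionVert a b (cycInterval q t m) s ≤ 6·q·(Nat.log 2 q + 3)` (pointwise, every class);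
* `unionTotal_cycInterval_le_log : unionTotal a b (cycInterval q t m) ≤ 6·q²·(Nat.log 2 q + 3)`;
* `classVert_le_of_interval_levels` / `totalVert_le_of_interval_levels`: if every level set of the third curve `c` is a cyclic
  interval and `c` takes `≤ k` values, then `V_s ≤ k·6q(log₂ q + 3)` for EVERY class and `T(a,b,c) ≤ k·6q²(log₂ q + 3)` — the
  `n = 3` law up to `log` on the interval-valued-third-curve stratum with an ARBITRARY pair `a, b` (the interval theorems of
  `…TotalsLawUnimodalClasses` needed `a, b` convexly ordered; a general pointwise class bound is false, `…TotalsLawParabolaGadget`).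

Mechanism (DYADIC WINDOWS).  The fibre union over a cyclic window is a union of TRANSLATED WINDOWS of the periodic point sequence
`n ↦ b n`: `U_s([t,t+m)) = ⋃_x (a x + b[σ_x, σ_x + m))` (`unionPts_cycInterval_eq`).  Every window of naturals inside `[0, 2^k)`
is a union of `≤ 2k + 2` dyadic blocks (`exists_dyadic_cover`, segment-tree decomposition), so the union regroups as
`⋃_D (A_D + B_D)` over dyadic blocks `D` (`B_D = b(D)`, `A_D` = the translations whose window uses `D`); a planar Minkowski sum has
`≤ #A_D + #B_D` hull vertices (`KPTT.PlanarMinkowski.ncard_extremePoints_add_le`), a union at most the sum over its parts, whence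
`#vert ≤ (k+1)2^k + (2k+2)·n` (`ncard_extremePoints_windows_le`); take `2^k ∈ (2q, 4q]`.  Honest label: the log-free rung and the
laws `UnionTotalsLaw C`, `TotalsLawThree C` remain OPEN and are asserted nowhere; nothing here bears on VP ≠ VNP.
[folklore: canonical dyadic decomposition of an interval; planar Minkowski vertex count]
-/

set_option linter.dupNamespace false -- `ValiantsHypothesis.ValiantsHypothesis` (summit = problem) in every name

open Finset
open scoped Pointwise

namespace Summit.ValiantsHypothesis.ValiantsHypothesis.Theorems.NewtonUnitEquationsDissociatedUniform

namespace TotalsLaw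

open Literature.Computability.AlgebraicComplexity.KPTT.PlanarMinkowski

/-- The dyadic block `[t·2^j, (t+1)·2^j)` coded by `(j, t)`. -/
def dyad (p : ℕ × ℕ) : Finset ℕ := Finset.Ico (p.2 * 2 ^ p.1) ((p.2 + 1) * 2 ^ p.1)

/-- The codes of the dyadic blocks inside `[0, 2^k)`: level `j ≤ k`, position `t < 2^(k-j)`. -/
def dyads (k : ℕ) : Finset (ℕ × ℕ) :=
  ((Finset.range (k + 1)) ×ˢ (Finset.range (2 ^ k))).filter fun p => p.2 < 2 ^ (k - p.1)

/-- Membership in `dyads`. [folklore] -/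
theorem mem_dyads {k : ℕ} {p : ℕ × ℕ} : p ∈ dyads k ↔ p.1 ≤ k ∧ p.2 < 2 ^ (k - p.1) := by
  unfold dyads
  simp only [Finset.mem_filter, Finset.mem_product, Finset.mem_range]
  exact ⟨fun ⟨⟨h1, _⟩, h3⟩ => ⟨by omega, h3⟩, fun ⟨h1, h2⟩ =>
    ⟨⟨by omega, lt_of_lt_of_le h2 (Nat.pow_le_pow_right (by norm_num) (Nat.sub_le _ _))⟩, h2⟩⟩

/-- A dyadic block of level `j` has `2^j` elements. [folklore] -/
theorem card_dyad (p : ℕ × ℕ) : (dyad p).card = 2 ^ p.1 := by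
  unfold dyad; rw [Nat.card_Ico, add_mul, one_mul, Nat.add_sub_cancel_left]

/-- `dyads` is monotone in the ambient level. [folklore] -/
theorem dyads_subset_succ (k : ℕ) : dyads k ⊆ dyads (k + 1) := by
  intro p hp; rw [mem_dyads] at hp ⊢
  exact ⟨by omega, lt_of_lt_of_le hp.2 (Nat.pow_le_pow_right (by norm_num) (by omega))⟩

/-- The shift of a block code by half the ambient range: `(j, t) ↦ (j, t + 2^(k-j))`. -/
def dyShift (k : ℕ) (p : ℕ × ℕ) : ℕ × ℕ := (p.1, p.2 + 2 ^ (k - p.1))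

/-- Shifting the code shifts the block by `2^k`. [folklore] -/
theorem dyad_dyShift {k : ℕ} {p : ℕ × ℕ} (hp : p.1 ≤ k) : dyad (dyShift k p) = (dyad p).image (· + 2 ^ k) := by
  unfold dyad dyShift; rw [Finset.image_add_right_Ico]
  have h : 2 ^ (k - p.1) * 2 ^ p.1 = 2 ^ k := by rw [← pow_add, Nat.sub_add_cancel hp]
  congr 1
  · rw [add_mul, h]
  · rw [show p.2 + 2 ^ (k - p.1) + 1 = (p.2 + 1) + 2 ^ (k - p.1) by ring, add_mul, h]

/-- Shifted codes of level-`k` blocks are level-`(k+1)` blocks. [folklore] -/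
theorem dyShift_mem {k : ℕ} {p : ℕ × ℕ} (hp : p ∈ dyads k) : dyShift k p ∈ dyads (k + 1) := by
  rw [mem_dyads] at hp ⊢
  refine ⟨by unfold dyShift; omega, ?_⟩
  show p.2 + 2 ^ (k - p.1) < 2 ^ (k + 1 - p.1)
  rw [show k + 1 - p.1 = (k - p.1) + 1 by omega, pow_succ]; omega

/-- The union of the shifted blocks is the shifted union. [folklore] -/
theorem biUnion_dyShift {k : ℕ} {S : Finset (ℕ × ℕ)} (hS : S ⊆ dyads k) :
    (S.image (dyShift k)).biUnion dyad = (S.biUnion dyad).image (· + 2 ^ k) := by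
  rw [Finset.biUnion_image, Finset.image_biUnion]
  exact Finset.biUnion_congr rfl fun p hp => dyad_dyShift (mem_dyads.1 (hS hp)).1

/-- Dyadic cover of a SUFFIX `[l, 2^k)` by at most `k + 1` blocks. [folklore] -/
theorem exists_dyadic_suffix (k : ℕ) : ∀ l, l ≤ 2 ^ k →
    ∃ S ⊆ dyads k, S.card ≤ k + 1 ∧ S.biUnion dyad = Finset.Ico l (2 ^ k) := by
  induction k with
  | zero =>
    intro l hl
    rcases Nat.eq_zero_or_pos l with rfl | hpos
    · refine ⟨{(0, 0)}, ?_, by simp, ?_⟩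
      · intro p hp; rw [Finset.mem_singleton.1 hp, mem_dyads]; simp
      · rw [Finset.singleton_biUnion]; rfl
    · refine ⟨∅, Finset.empty_subset _, by simp, ?_⟩
      rw [Finset.biUnion_empty, eq_comm, Finset.Ico_eq_empty_iff]; simp at hl ⊢; omega
  | succ k ih =>
    intro l hl; by_cases h : 2 ^ k ≤ l
    · obtain ⟨S, hS, hcard, hU⟩ := ih (l - 2 ^ k) (by rw [pow_succ] at hl; omega)
      refine ⟨S.image (dyShift k), fun p hp => ?_, Finset.card_image_le.trans (hcard.trans (by omega)), ?_⟩
      · obtain ⟨p', hp', rfl⟩ := Finset.mem_image.1 hp; exact dyShift_mem (hS hp')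
      · rw [biUnion_dyShift hS, hU, Finset.image_add_right_Ico, Nat.sub_add_cancel h, ← two_mul, ← pow_succ']
    · push Not at h
      obtain ⟨S, hS, hcard, hU⟩ := ih l h.le
      refine ⟨insert (k, 1) S, ?_, (Finset.card_insert_le _ _).trans (by omega), ?_⟩
      · intro p hp
        rcases Finset.mem_insert.1 hp with rfl | hp
        · rw [mem_dyads]; simp
        · exact dyads_subset_succ k (hS hp)
      · rw [Finset.biUnion_insert, hU]; unfold dyad
        rw [one_mul, show (1 + 1) * 2 ^ k = 2 ^ (k + 1) by ring, Finset.union_comm]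
        exact Finset.Ico_union_Ico_eq_Ico h.le (by rw [pow_succ]; omega)

/-- Dyadic cover of a PREFIX `[0, u)` by at most `k + 1` blocks. [folklore] -/
theorem exists_dyadic_prefix (k : ℕ) : ∀ u, u ≤ 2 ^ k →
    ∃ S ⊆ dyads k, S.card ≤ k + 1 ∧ S.biUnion dyad = Finset.Ico 0 u := by
  induction k with
  | zero =>
    intro u hu
    rcases Nat.eq_zero_or_pos u with rfl | hpos
    · exact ⟨∅, Finset.empty_subset _, by simp, by rw [Finset.biUnion_empty, Finset.Ico_self]⟩
    · refine ⟨{(0, 0)}, ?_, by simp, ?_⟩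
      · intro p hp; rw [Finset.mem_singleton.1 hp, mem_dyads]; simp
      · obtain rfl : u = 1 := by simp at hu; omega
        rw [Finset.singleton_biUnion]; unfold dyad; norm_num
  | succ k ih =>
    intro u hu; by_cases h : u ≤ 2 ^ k
    · obtain ⟨S, hS, hcard, hU⟩ := ih u h
      exact ⟨S, hS.trans (dyads_subset_succ k), hcard.trans (by omega), hU⟩
    · push Not at h
      obtain ⟨S, hS, hcard, hU⟩ := ih (u - 2 ^ k) (by rw [pow_succ] at hu; omega)
      refine ⟨insert (k, 0) (S.image (dyShift k)), ?_, ?_, ?_⟩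
      · intro p hp
        rcases Finset.mem_insert.1 hp with rfl | hp
        · rw [mem_dyads]; simp
        · obtain ⟨p', hp', rfl⟩ := Finset.mem_image.1 hp; exact dyShift_mem (hS hp')
      · calc (insert (k, 0) (S.image (dyShift k))).card ≤ (S.image (dyShift k)).card + 1 := Finset.card_insert_le _ _
          _ ≤ S.card + 1 := Nat.add_le_add_right Finset.card_image_le _
          _ ≤ k + 1 + 1 := by omega
      · rw [Finset.biUnion_insert, biUnion_dyShift hS, hU, Finset.image_add_right_Ico, zero_add,
          Nat.sub_add_cancel h.le]
        unfold dyad; rw [zero_mul, zero_add, one_mul]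
        exact Finset.Ico_union_Ico_eq_Ico (Nat.zero_le _) h.le

/-- **Dyadic cover of a window.**  Every `[l, u) ⊆ [0, 2^k)` is the union of at most `2k + 2` dyadic blocks. [folklore:
the canonical segment-tree decomposition] -/
theorem exists_dyadic_cover (k : ℕ) : ∀ l u, l ≤ u → u ≤ 2 ^ k →
    ∃ S ⊆ dyads k, S.card ≤ 2 * k + 2 ∧ S.biUnion dyad = Finset.Ico l u := by
  induction k with
  | zero =>
    intro l u hlu hu
    rcases Nat.eq_zero_or_pos l with rfl | hpos
    · obtain ⟨S, hS, hc, hU⟩ := exists_dyadic_prefix 0 u hu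
      exact ⟨S, hS, hc.trans (by omega), hU⟩
    · refine ⟨∅, Finset.empty_subset _, by simp, ?_⟩
      rw [Finset.biUnion_empty, eq_comm, Finset.Ico_eq_empty_iff]; simp at hu; omega
  | succ k ih =>
    intro l u hlu hu
    by_cases h1 : u ≤ 2 ^ k
    · obtain ⟨S, hS, hcard, hU⟩ := ih l u hlu h1
      exact ⟨S, hS.trans (dyads_subset_succ k), hcard.trans (by omega), hU⟩
    by_cases h2 : 2 ^ k ≤ l
    · obtain ⟨S, hS, hcard, hU⟩ := ih (l - 2 ^ k) (u - 2 ^ k) (by omega) (by rw [pow_succ] at hu; omega)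
      refine ⟨S.image (dyShift k), fun p hp => ?_, Finset.card_image_le.trans (hcard.trans (by omega)), ?_⟩
      · obtain ⟨p', hp', rfl⟩ := Finset.mem_image.1 hp; exact dyShift_mem (hS hp')
      · rw [biUnion_dyShift hS, hU, Finset.image_add_right_Ico, Nat.sub_add_cancel h2,
          Nat.sub_add_cancel (h2.trans hlu)]
    · push Not at h1 h2
      obtain ⟨S₁, hS₁, hc₁, hU₁⟩ := exists_dyadic_suffix k l h2.le
      obtain ⟨S₂, hS₂, hc₂, hU₂⟩ := exists_dyadic_prefix k (u - 2 ^ k) (by rw [pow_succ] at hu; omega)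
      refine ⟨S₁ ∪ S₂.image (dyShift k), ?_, ?_, ?_⟩
      · intro p hp
        rcases Finset.mem_union.1 hp with hp | hp
        · exact dyads_subset_succ k (hS₁ hp)
        · obtain ⟨p', hp', rfl⟩ := Finset.mem_image.1 hp; exact dyShift_mem (hS₂ hp')
      · calc (S₁ ∪ S₂.image (dyShift k)).card ≤ S₁.card + (S₂.image (dyShift k)).card := Finset.card_union_le _ _
          _ ≤ (k + 1) + (k + 1) := add_le_add hc₁ (Finset.card_image_le.trans hc₂)
          _ ≤ 2 * (k + 1) + 2 := by omega
      · rw [Finset.union_biUnion, biUnion_dyShift hS₂, hU₁, hU₂, Finset.image_add_right_Ico, zero_add,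
          Nat.sub_add_cancel h1.le]
        exact Finset.Ico_union_Ico_eq_Ico h2.le h1.le

/-- `∑_{D ∈ dyads k} #D = (k+1)·2^k`, in the form of an upper bound. [folklore] -/
theorem sum_card_dyad_le (k : ℕ) : ∑ p ∈ dyads k, (dyad p).card ≤ (k + 1) * 2 ^ k := by
  unfold dyads; rw [Finset.sum_filter, Finset.sum_product]; refine le_of_eq ?_
  calc ∑ j ∈ Finset.range (k + 1), ∑ t ∈ Finset.range (2 ^ k),
          (if (j, t).2 < 2 ^ (k - (j, t).1) then (dyad (j, t)).card else 0)
      = ∑ j ∈ Finset.range (k + 1), ∑ t ∈ Finset.range (2 ^ k), (if t < 2 ^ (k - j) then 2 ^ j else 0) := by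
        exact Finset.sum_congr rfl fun j _ => Finset.sum_congr rfl fun t _ => by simp only [card_dyad]
    _ = ∑ j ∈ Finset.range (k + 1), 2 ^ k := by
        refine Finset.sum_congr rfl fun j hj => ?_
        rw [← Finset.sum_filter]
        have hf : (Finset.range (2 ^ k)).filter (fun t => t < 2 ^ (k - j)) = Finset.range (2 ^ (k - j)) := by
          ext t; simp only [Finset.mem_filter, Finset.mem_range]
          exact ⟨fun h => h.2, fun h => ⟨lt_of_lt_of_le h (Nat.pow_le_pow_right (by norm_num) (Nat.sub_le _ _)), h⟩⟩
        rw [hf, Finset.sum_const, Finset.card_range, smul_eq_mul, ← pow_add,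
          Nat.sub_add_cancel (by have := Finset.mem_range.1 hj; omega)]
    _ = (k + 1) * 2 ^ k := by rw [Finset.sum_const, Finset.card_range, smul_eq_mul]

/-- **Unions of translated windows.**  For a point sequence `b : ℕ → ℝ²`, translations `v i` and windows `[l i, u i) ⊆ [0, 2^k)`
(`i : ι`), the union `⋃ i, (v i + b[l i, u i))` has at most `(k+1)·2^k + (2k+2)·|ι|` hull vertices: write every window as
`≤ 2k+2` dyadic blocks, regroup the union as `⋃_D (A_D + B_D)` over the blocks, and use the planar Minkowski vertex count on each
piece. [folklore] -/
theorem ncard_extremePoints_windows_le {ι : Type*} [Fintype ι] (b : ℕ → (Fin 2 → ℝ)) (v : ι → (Fin 2 → ℝ))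
    (l u : ι → ℕ) (k : ℕ) (hlu : ∀ i, l i ≤ u i) (hu : ∀ i, u i ≤ 2 ^ k) :
    (Set.extremePoints ℝ (convexHull ℝ (⋃ i, (v i +ᵥ (b '' Set.Ico (l i) (u i)))))).ncard ≤
      (k + 1) * 2 ^ k + (2 * k + 2) * Fintype.card ι := by
  classical
  have hdec : ∀ i, ∃ S ⊆ dyads k, S.card ≤ 2 * k + 2 ∧ S.biUnion dyad = Finset.Ico (l i) (u i) :=
    fun i => exists_dyadic_cover k (l i) (u i) (hlu i) (hu i)
  choose dec hdecD hdecC hdecU using hdec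
  set A : ℕ × ℕ → Finset (Fin 2 → ℝ) := fun p => (univ.filter fun i => p ∈ dec i).image v with hA
  set B : ℕ × ℕ → Finset (Fin 2 → ℝ) := fun p => (dyad p).image b with hB
  have hU : (⋃ i, (v i +ᵥ (b '' Set.Ico (l i) (u i)))) =
      (((dyads k).biUnion fun p => A p + B p : Finset (Fin 2 → ℝ)) : Set (Fin 2 → ℝ)) := by
    ext y
    simp only [Set.mem_iUnion, Finset.coe_biUnion, Finset.mem_coe]
    constructor
    · rintro ⟨i, hy⟩
      rw [Set.mem_vadd_set] at hy
      obtain ⟨z, ⟨n, hn, rfl⟩, rfl⟩ := hy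
      have hn' : n ∈ (dec i).biUnion dyad := by
        rw [hdecU]; exact Finset.mem_Ico.2 ⟨hn.1, hn.2⟩
      obtain ⟨p, hp, hnp⟩ := Finset.mem_biUnion.1 hn'
      refine ⟨p, hdecD i hp, ?_⟩
      rw [Finset.mem_add]
      exact ⟨v i, Finset.mem_image.2 ⟨i, Finset.mem_filter.2 ⟨Finset.mem_univ _, hp⟩, rfl⟩, b n,
        Finset.mem_image.2 ⟨n, hnp, rfl⟩, (vadd_eq_add _ _).symm⟩
    · rintro ⟨p, -, hy⟩
      rw [Finset.mem_add] at hy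
      obtain ⟨w, hw, z, hz, rfl⟩ := hy
      obtain ⟨i, hi, rfl⟩ := Finset.mem_image.1 hw
      obtain ⟨n, hn, rfl⟩ := Finset.mem_image.1 hz
      have hpi : p ∈ dec i := (Finset.mem_filter.1 hi).2
      have hn' : n ∈ Finset.Ico (l i) (u i) := by
        rw [← hdecU]; exact Finset.mem_biUnion.2 ⟨p, hpi, hn⟩
      refine ⟨i, ?_⟩
      rw [Set.mem_vadd_set]
      exact ⟨b n, ⟨n, ⟨(Finset.mem_Ico.1 hn').1, (Finset.mem_Ico.1 hn').2⟩, rfl⟩, vadd_eq_add _ _⟩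
  rw [hU]
  refine (ncard_extremePoints_biUnion_le (dyads k) fun p => A p + B p).trans ?_
  have hpiece : ∀ p ∈ dyads k,
      ((convexHull ℝ ((A p + B p : Finset (Fin 2 → ℝ)) : Set (Fin 2 → ℝ))).extremePoints ℝ).ncard ≤
        (A p).card + (dyad p).card := by
    intro p _
    by_cases hAe : A p = ∅
    · rw [hAe, Finset.empty_add]; simp
    · have hAne : (A p).Nonempty := Finset.nonempty_iff_ne_empty.2 hAe
      have hBne : (B p).Nonempty := by
        have hd : (dyad p).Nonempty := by
          rw [← Finset.card_pos, card_dyad]; positivity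
        exact hd.image b
      refine (ncard_extremePoints_add_le hAne hBne).trans ?_
      exact add_le_add (ncard_extremePoints_le_card _)
        ((ncard_extremePoints_le_card _).trans Finset.card_image_le)
  refine (Finset.sum_le_sum hpiece).trans ?_
  rw [Finset.sum_add_distrib]
  have hAsum : ∑ p ∈ dyads k, (A p).card ≤ (2 * k + 2) * Fintype.card ι := by
    calc ∑ p ∈ dyads k, (A p).card ≤ ∑ p ∈ dyads k, (univ.filter fun i => p ∈ dec i).card :=
          Finset.sum_le_sum fun p _ => Finset.card_image_le
      _ = ∑ p ∈ dyads k, ∑ i, (if p ∈ dec i then 1 else 0) := by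
          exact Finset.sum_congr rfl fun p _ => by rw [Finset.card_filter]
      _ = ∑ i, ∑ p ∈ dyads k, (if p ∈ dec i then 1 else 0) := Finset.sum_comm
      _ = ∑ i, (dec i).card := by
          refine Finset.sum_congr rfl fun i _ => ?_
          rw [← Finset.card_filter]
          congr 1; ext p; simp only [Finset.mem_filter]
          exact ⟨fun h => h.2, fun h => ⟨hdecD i h, h⟩⟩
      _ ≤ ∑ _i : ι, (2 * k + 2) := Finset.sum_le_sum fun i _ => hdecC i
      _ = (2 * k + 2) * Fintype.card ι := by rw [Finset.sum_const, Finset.card_univ, smul_eq_mul, mul_comm]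
  have hBsum := sum_card_dyad_le k; omega

section Cyclic
variable {q : ℕ} [NeZero q]

/-- The start (as a natural `< q`) of the window of `b`-labels met by the translate `a x` in `U_s([t, t+m))`:
`{y : s - x - y ∈ [t, t+m)} = {σ + j : j < m}` with `σ = (s - x - t - (m-1)).val`. -/
def winStart (t m : ℕ) (s x : ZMod q) : ℕ := (s - x - (t : ZMod q) - ((m - 1 : ℕ) : ZMod q)).val

/-- `winStart < q`. [folklore] -/
theorem winStart_lt (t m : ℕ) (s x : ZMod q) : winStart t m s x < q := ZMod.val_lt _

/-- **The fibre union over a cyclic window is a union of translated windows of the sequence `n ↦ b n`.** [folklore] -/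
theorem unionPts_cycInterval_eq (a b : ZMod q → (Fin 2 → ℝ)) (t m : ℕ) (s : ZMod q) :
    unionPts a b (cycInterval q t m : Set (ZMod q)) s =
      ⋃ x : ZMod q, (a x +ᵥ ((fun n : ℕ => b (n : ZMod q)) ''
        Set.Ico (winStart t m s x) (winStart t m s x + m))) := by
  ext p
  rw [mem_unionPts]; simp only [Set.mem_iUnion]
  constructor
  · rintro ⟨x, y, hZ, rfl⟩
    rw [Finset.mem_coe, cycInterval, Finset.mem_image] at hZ
    obtain ⟨i, hi, hiy⟩ := hZ; rw [Finset.mem_range] at hi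
    refine ⟨x, ?_⟩
    rw [Set.mem_vadd_set]
    refine ⟨b y, ⟨winStart t m s x + (m - 1 - i), ⟨Nat.le_add_right _ _, by omega⟩, ?_⟩, vadd_eq_add _ _⟩
    -- the label `y` is the residue of `σ + (m - 1 - i)`
    show b (((winStart t m s x + (m - 1 - i) : ℕ) : ZMod q)) = b y
    congr 1
    have hy : y = s - x - ((t + i : ℕ) : ZMod q) := by rw [hiy]; abel
    rw [hy, Nat.cast_add, winStart, ZMod.natCast_zmod_val, Nat.cast_sub (by omega : i ≤ m - 1)]
    push_cast
    ring
  · rintro ⟨x, hp⟩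
    rw [Set.mem_vadd_set] at hp
    obtain ⟨z, ⟨n, hn, rfl⟩, rfl⟩ := hp
    refine ⟨x, (n : ZMod q), ?_, vadd_eq_add _ _⟩
    rw [Finset.mem_coe, cycInterval, Finset.mem_image]
    obtain ⟨hn1, hn2⟩ := hn
    set σ := winStart t m s x with hσdef
    refine ⟨m - 1 - (n - σ), Finset.mem_range.2 (by omega), ?_⟩
    have hσ : ((σ : ℕ) : ZMod q) = s - x - (t : ZMod q) - ((m - 1 : ℕ) : ZMod q) := by
      rw [hσdef]; unfold winStart; exact ZMod.natCast_zmod_val _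
    have hn_eq : ((n : ℕ) : ZMod q) = ((σ : ℕ) : ZMod q) + ((n - σ : ℕ) : ZMod q) := by
      rw [← Nat.cast_add]; congr 1; omega
    have hi : ((m - 1 - (n - σ) : ℕ) : ZMod q) = ((m - 1 : ℕ) : ZMod q) - ((n - σ : ℕ) : ZMod q) :=
      Nat.cast_sub (by omega)
    rw [Nat.cast_add, hi, hn_eq, hσ]
    ring

/-- A cyclic window of length `≥ q` is everything. [folklore] -/
theorem cycInterval_eq_univ_of_le (t : ℕ) {m : ℕ} (hm : q ≤ m) : cycInterval q t m = Finset.univ := by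
  refine Finset.eq_univ_of_forall fun r => ?_; rw [cycInterval, Finset.mem_image]
  refine ⟨(r - (t : ZMod q)).val, Finset.mem_range.2 (lt_of_lt_of_le (ZMod.val_lt _) hm), ?_⟩
  push_cast; rw [ZMod.natCast_zmod_val]; ring

/-- **The interval union bound up to `log`, pointwise, for ARBITRARY pairs:**
`#vert conv U_s([t, t+m)) ≤ 6·q·(log₂ q + 3)` for all `a b : ℤ/q → ℝ²`, all `t m s`. -/
theorem unionVert_cycInterval_le_log (a b : ZMod q → (Fin 2 → ℝ)) (t m : ℕ) (s : ZMod q) :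
    unionVert a b (cycInterval q t m : Set (ZMod q)) s ≤ 6 * q * (Nat.log 2 q + 3) := by
  -- reduce to windows of length `≤ q`
  wlog hm : m ≤ q generalizing m
  · have h := this q le_rfl
    rwa [cycInterval_eq_univ_of_le t le_rfl, ← cycInterval_eq_univ_of_le t (le_of_not_ge hm)] at h
  have hq : 0 < q := Nat.pos_of_ne_zero (NeZero.ne q)
  set k := Nat.log 2 q + 2 with hk
  have hlt : q < 2 ^ (Nat.log 2 q + 1) := Nat.lt_pow_succ_log_self (by norm_num) q
  have hk1 : 2 * q ≤ 2 ^ k := by rw [hk, pow_succ]; omega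
  have hk2 : 2 ^ k ≤ 4 * q := by
    have := Nat.pow_log_le_self 2 hq.ne'
    rw [hk, pow_succ, pow_succ]; omega
  unfold unionVert; rw [unionPts_cycInterval_eq]
  have hmain := ncard_extremePoints_windows_le (fun n : ℕ => b (n : ZMod q)) a (winStart t m s)
    (fun x => winStart t m s x + m) k (fun x => Nat.le_add_right _ _)
    (fun x => by have := winStart_lt t m s x; omega)
  rw [ZMod.card] at hmain
  calc _ ≤ (k + 1) * 2 ^ k + (2 * k + 2) * q := hmain
    _ ≤ (k + 1) * (4 * q) + (2 * k + 2) * q := by gcongr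
    _ = 6 * q * (Nat.log 2 q + 3) := by rw [hk]; ring

/-- **The interval union TOTALS up to `log`:** `∑_s #vert conv U_s([t,t+m)) ≤ 6·q²·(log₂ q + 3)` for all `a, b`. -/
theorem unionTotal_cycInterval_le_log (a b : ZMod q → (Fin 2 → ℝ)) (t m : ℕ) :
    unionTotal a b (cycInterval q t m : Set (ZMod q)) ≤ 6 * q ^ 2 * (Nat.log 2 q + 3) := by
  unfold unionTotal
  calc ∑ s, unionVert a b (cycInterval q t m : Set (ZMod q)) s ≤ ∑ _s : ZMod q, 6 * q * (Nat.log 2 q + 3) :=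
        Finset.sum_le_sum fun s _ => unionVert_cycInterval_le_log a b t m s
    _ = 6 * q ^ 2 * (Nat.log 2 q + 3) := by rw [Finset.sum_const, Finset.card_univ, ZMod.card, smul_eq_mul]; ring

/-- **The `n = 3` law up to `log` for an interval-valued third curve, POINTWISE:** if every level set of `c` is a cyclic
interval and `c` takes at most `k` values, then `V_s ≤ k·6q(log₂ q + 3)` for every class `s` — with `a, b` ARBITRARY. -/
theorem classVert_le_of_interval_levels (a b c : ZMod q → (Fin 2 → ℝ)) [DecidableEq (Fin 2 → ℝ)]
    (hc : ∀ v, ∃ t m, c ⁻¹' {v} = (cycInterval q t m : Set (ZMod q))) {k : ℕ}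
    (hk : (Finset.univ.image c).card ≤ k) (s : ZMod q) :
    classVert a b c s ≤ k * (6 * q * (Nat.log 2 q + 3)) := by
  calc classVert a b c s ≤ ∑ v ∈ Finset.univ.image c, unionVert a b (c ⁻¹' {v}) s :=
        classVert_le_sum_unionVert a b c s
    _ ≤ ∑ _v ∈ Finset.univ.image c, 6 * q * (Nat.log 2 q + 3) :=
        Finset.sum_le_sum fun v _ => by
          obtain ⟨t, m, h⟩ := hc v
          rw [h]
          exact unionVert_cycInterval_le_log a b t m s
    _ ≤ k * (6 * q * (Nat.log 2 q + 3)) := by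
        rw [Finset.sum_const, smul_eq_mul]
        exact Nat.mul_le_mul_right _ hk

/-- **… and in TOTAL:** `T(a,b,c) ≤ k·6q²(log₂ q + 3)` for `a, b` arbitrary and `c` taking `≤ k` values on cyclic-interval
level sets (e.g. the indicator of an interval: `k = 2`). -/
theorem totalVert_le_of_interval_levels (a b c : ZMod q → (Fin 2 → ℝ)) [DecidableEq (Fin 2 → ℝ)]
    (hc : ∀ v, ∃ t m, c ⁻¹' {v} = (cycInterval q t m : Set (ZMod q))) {k : ℕ}
    (hk : (Finset.univ.image c).card ≤ k) :
    totalVert a b c ≤ k * (6 * q ^ 2 * (Nat.log 2 q + 3)) := by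
  unfold totalVert
  calc ∑ s, classVert a b c s ≤ ∑ _s : ZMod q, k * (6 * q * (Nat.log 2 q + 3)) :=
        Finset.sum_le_sum fun s _ => classVert_le_of_interval_levels a b c hc hk s
    _ = k * (6 * q ^ 2 * (Nat.log 2 q + 3)) := by
        rw [Finset.sum_const, Finset.card_univ, ZMod.card, smul_eq_mul]; ring

end Cyclic

end TotalsLaw

end Summit.ValiantsHypothesis.ValiantsHypothesis.Theorems.NewtonUnitEquationsDissociatedUniform
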